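import Literature.MathematicalPhysics.StatisticalMechanics.HcpFccLatticeSumsTail

/-!
# `OverbindingBudget` / crux `RobustDefectLimitWindows` (stmt-AtomisticToContinuum-31280) — «RunCut» S3c-I: chirality lattice constants

Support file (lens-4 g86, residual programme «AffineRunCut», competitor leaf of record **SW♭**
`…OverbindingBudgetAffineRunCutFlat.StackSwapGainFlat(Wide)`, critic row 1526: GATE SW-G1 = item S3c of the memo
`decomp-a2c-lens-4/g85/memo/SW-S3.md` §2.3, the CHIRALITY cross term; full derivation in `g86/memo/SW-G1.md`).

THE OBJECT.  For one flipped pair of adjacent close-packed layers (offset `+w ↦ −w`, `|w|² = 1/3`, ideal layer distance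
`c² = 2/3`, unit in-layer spacing, the pair at the site's own scale `a`) under a homogeneous distortion `q ↦ (1+S)q`, the
difference `D₁(S) = Φ₁(−w; S) − Φ₁(+w; S)` of the Lennard-Jones bilayer sums (`V = r⁻¹²/12 − r⁻⁶/6`) is odd under the in-plane
point reflection and `C₃ᵥ`-covariant, so its Taylor expansion at `S = 0` starts with ONE bilinear term `κ(a)·⟨d, τ⟩` (deviatoric
in-plane strain `d`, amplitude `s`; out-of-plane engineering shear `τ`, amplitude `γ`).  Termwise differentiation at `S = 0`
(`r² = (1+s)²qₓ² + ((1−s)q_y + γ√(2/3))² + 2/3`, `∂ₛ∂_γ`) and the `C₃` average over the orbit of `(i,j) ↦ (−i−j−1, i)` (which kills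
the linear weights `∑ q_y·g(r²)` and reduces every cubic weight odd in `q_y` to a multiple of `Im(qₓ + i q_y)³`) give

  `κ(a) = (√2/18) · ( (7/2)·T₆·a⁻¹² − 2·T₃·a⁻⁶ )`,   `T_n = ∑_{(i,j) ∈ ℤ²} C(i,j) · D(i,j)^{−(n+2)}`,

with the INTEGER cubic `C(i,j) = (3j+1)(9(2i+j+1)² − (3j+1)²) = 24√3·Im(qₓ + i q_y)³` and the INTEGER squared bond length
`D(i,j) = i² + ij + j² + i + j + 1 = Q₁(i,j) + 2/3` (`Q₁ = stackForm 1` of the audited `StackingSums` kit).  The three nearest bonds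
(`D = 1`, `C = 8`) contribute `24` to every `T_n`; the rest is small and signed (`T₃ = 19.6687…`, `T₆ = 23.31993…`).  Cross-check
(evidence `g86/numerics/chi2.py`): the central mixed second difference of the actual strained bilayer energy reproduces the formula
(`36.88805` at `a = 17/20`; the memo's `36.94` at `θ = 10⁻³` carried the third-order bias).

THIS FILE (definitions + soundness, no kernel facts): `chiCubic`, `chiDen`, `chiTerm`, `chiSum`, `kappaLJ`; the identity
`1728·Q₁³ − C² = 27·X²(X² − Y²)²`, hence `|C| ≤ 42·D²` and `|C| ≤ (72/(R+1))·D²` outside `box R`; summability; the kernel evaluators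
`chiFloorSum sgn R e M = ∑_{|i|,|j| ≤ R} C^{±}·⌊M/Dᵉ⌋`, `chiMass sgn R = ∑ C^{±}` (structural recursion, `decide +kernel`-evaluable like
the kit's `boxFloorSum`) with soundness; the tail through the kit's `tsum_compl_box_le`; the PARAMETRIC ENCLOSURE `chiSum_mem_of_kernel`.
Kernel facts and numeric corollaries (`κ ≤ 40` for `a ≥ 106/125`, `κ(21/25) ≥ 43`, …) are in `…RunCutChiralKernel`; the Taylor link
«second-order coefficient of `D₁` = `κ·s·γ`» is the first stub of the S3 remainder file (hand-in 3).
[this file: definitions + [folklore] numerics bookkeeping; standard axioms]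
-/

noncomputable section

namespace Summit.AtomisticToContinuum.Crystallization.Theorems.OverbindingBudgetAffineRunCutChiral

open Finset
open Literature.MathematicalPhysics.StatisticalMechanics.StackingSums

/-! ## The chirality lattice constants -/

/-- **The chirality cubic** `C(i,j) = (3j+1)(9(2i+j+1)² − (3j+1)²)` — `24√3 · Im (qₓ + i q_y)³` for the offset-layer point
`q = i u + j v + w` (`qₓ = (2i+j+1)/2`, `q_y = √3(3j+1)/6`). [this file · kind: definition] -/
def chiCubic (i j : ℤ) : ℤ :=
  (3 * j + 1) * (9 * (2 * i + j + 1) ^ 2 - (3 * j + 1) ^ 2)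

/-- **The integer squared bond length** `D(i,j) = i² + ij + j² + i + j + 1 = Q₁(i,j) + 2/3` of the adjacent-layer bond
(ideal ratio `c² = 2/3`, unit in-layer spacing). [this file · kind: definition] -/
def chiDen (i j : ℤ) : ℤ :=
  i * i + i * j + j * j + i + j + 1

/-- **The chirality term** `C(i,j) · (Q₁(i,j) + 2/3)^{-(n+2)}` (the kit's `layerTerm` at pattern `1`, shift `2/3`).
[this file · kind: definition] -/
def chiTerm (n : ℕ) (ij : ℤ × ℤ) : ℝ :=
  (chiCubic ij.1 ij.2 : ℝ) * layerTerm 1 (n + 2) (2 / 3) ij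

/-- **The chirality lattice constant** `T_n = ∑_{(i,j) ∈ ℤ²} C(i,j) · D(i,j)^{-(n+2)}` (`T₃ = 19.6687…`, `T₆ = 23.31993…`).
[this file · kind: definition] -/
def chiSum (n : ℕ) : ℝ :=
  ∑' ij : ℤ × ℤ, chiTerm n ij

/-- **The chirality coefficient of the Lennard-Jones flipped pair at own scale `a`**:
`κ(a) = (√2/18)·((7/2)·T₆·a⁻¹² − 2·T₃·a⁻⁶)` (per flipped adjacent pair, per unit deviatoric strain and unit engineering shear).
[this file · kind: definition] -/
def kappaLJ (a : ℝ) : ℝ :=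
  Real.sqrt 2 / 18 * (7 / 2 * (a⁻¹) ^ 12 * chiSum 6 - 2 * (a⁻¹) ^ 6 * chiSum 3)

/-! ## Elementary facts about `C` and `D` -/

/-- `D = Q₁ + 2/3` as reals. [folklore] -/
theorem chiDen_cast (i j : ℤ) : (chiDen i j : ℝ) = stackForm 1 i j + 2 / 3 := by
  unfold chiDen
  rw [stackForm_one]
  push_cast
  ring

/-- `D ≥ 1` (an integer exceeding `1/12 + 2/3`). [folklore] -/
theorem one_le_chiDen (i j : ℤ) : 1 ≤ chiDen i j := by
  have h : (0 : ℝ) < (chiDen i j : ℝ) := by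
    rw [chiDen_cast]; linarith [stackForm_one_pos i j]
  have : (0 : ℤ) < chiDen i j := by exact_mod_cast h
  omega

/-- `D > 0` as a real. [folklore] -/
theorem chiDen_pos (i j : ℤ) : (0 : ℝ) < (chiDen i j : ℝ) := by
  have := one_le_chiDen i j
  have : (1 : ℝ) ≤ (chiDen i j : ℝ) := by exact_mod_cast this
  linarith

/-- The kit's layer term at pattern `1`, shift `2/3` is `D^{-m}`. [folklore] -/
theorem layerTerm_one_twoThirds (m : ℕ) (ij : ℤ × ℤ) :
    layerTerm 1 m (2 / 3) ij = ((chiDen ij.1 ij.2 : ℝ)⁻¹) ^ m := by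
  unfold layerTerm
  rw [chiDen_cast]

/-- **The cubic identity** `1728·Q₁³ − C² = 27·X²·(X² − Y²)²`, `X = 2i+j+1`, `Y = 3j+1` (i.e. `|z|⁶ = (Re z³)² + (Im z³)²`).
[folklore] -/
theorem chiCubic_identity (i j : ℤ) :
    1728 * stackForm 1 i j ^ 3 - (chiCubic i j : ℝ) ^ 2 =
      27 * ((2 * (i : ℝ) + j + 1) ^ 2) * ((2 * (i : ℝ) + j + 1) ^ 2 - (3 * (j : ℝ) + 1) ^ 2) ^ 2 := by
  unfold chiCubic
  rw [stackForm_one]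
  push_cast
  ring

/-- `C² ≤ 1728·Q₁³`. [folklore] -/
theorem chiCubic_sq_le (i j : ℤ) : (chiCubic i j : ℝ) ^ 2 ≤ 1728 * stackForm 1 i j ^ 3 := by
  have h := chiCubic_identity i j
  nlinarith [sq_nonneg (2 * (i : ℝ) + j + 1), sq_nonneg ((2 * (i : ℝ) + j + 1) ^ 2 - (3 * (j : ℝ) + 1) ^ 2),
    mul_nonneg (sq_nonneg (2 * (i : ℝ) + j + 1)) (sq_nonneg ((2 * (i : ℝ) + j + 1) ^ 2 - (3 * (j : ℝ) + 1) ^ 2))]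

/-- **Global weight bound** `|C| ≤ 42·D²`. [folklore] -/
theorem abs_chiCubic_le (i j : ℤ) : |(chiCubic i j : ℝ)| ≤ 42 * (chiDen i j : ℝ) ^ 2 := by
  have hQ : 0 ≤ stackForm 1 i j := by linarith [stackForm_one_pos i j]
  have hD1 : (1 : ℝ) ≤ (chiDen i j : ℝ) := by exact_mod_cast one_le_chiDen i j
  have hQD : stackForm 1 i j ≤ (chiDen i j : ℝ) := by rw [chiDen_cast]; linarith
  have hsq := chiCubic_sq_le i j
  apply abs_le_of_sq_le_sq _ (by positivity)
  have h3 : stackForm 1 i j ^ 3 ≤ (chiDen i j : ℝ) ^ 3 := pow_le_pow_left₀ hQ hQD 3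
  have h4 : (chiDen i j : ℝ) ^ 3 ≤ (chiDen i j : ℝ) ^ 4 := by
    calc (chiDen i j : ℝ) ^ 3 = (chiDen i j : ℝ) ^ 3 * 1 := by ring
      _ ≤ (chiDen i j : ℝ) ^ 3 * (chiDen i j : ℝ) := by
          exact mul_le_mul_of_nonneg_left hD1 (by positivity)
      _ = (chiDen i j : ℝ) ^ 4 := by ring
  nlinarith

/-- **Shell weight bound**: outside `box R`, `|C| ≤ (72/(R+1))·D²` (`Q₁ ≥ (R+1)²/3` there). [folklore] -/
theorem abs_chiCubic_le_of_not_mem_box {R : ℕ} {ij : ℤ × ℤ} (h : ij ∉ box R) :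
    |(chiCubic ij.1 ij.2 : ℝ)| ≤ 72 / ((R : ℝ) + 1) * (chiDen ij.1 ij.2 : ℝ) ^ 2 := by
  obtain ⟨i, j⟩ := ij
  have hshell : 1 / 3 * ((R + 1 : ℕ) : ℝ) ^ 2 ≤ stackForm 1 i j :=
    stackForm_one_shell (m := R + 1) (by omega) i j (by
      have := not_mem_box.1 h; push_cast; simpa using this)
  push_cast at hshell
  have hQ : 0 ≤ stackForm 1 i j := by linarith [stackForm_one_pos i j]
  have hQD : stackForm 1 i j ≤ (chiDen i j : ℝ) := by rw [chiDen_cast]; linarith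
  have hR : (0 : ℝ) < (R : ℝ) + 1 := by positivity
  have hsq := chiCubic_sq_le i j
  apply abs_le_of_sq_le_sq _ (by positivity)
  -- `C² ≤ 1728 Q₁³ ≤ 5184 Q₁⁴/(R+1)² ≤ (72 D²/(R+1))²`
  have h1 : 1728 * stackForm 1 i j ^ 3 * ((R : ℝ) + 1) ^ 2 ≤ 5184 * stackForm 1 i j ^ 4 := by
    have : stackForm 1 i j ^ 3 * ((R : ℝ) + 1) ^ 2 ≤ stackForm 1 i j ^ 3 * (3 * stackForm 1 i j) :=
      mul_le_mul_of_nonneg_left (by linarith) (by positivity)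
    nlinarith
  have h2 : stackForm 1 i j ^ 4 ≤ (chiDen i j : ℝ) ^ 4 := pow_le_pow_left₀ hQ hQD 4
  rw [show (72 / ((R : ℝ) + 1) * (chiDen i j : ℝ) ^ 2) ^ 2 = 5184 * (chiDen i j : ℝ) ^ 4 / ((R : ℝ) + 1) ^ 2 by
    field_simp; ring]
  rw [le_div_iff₀ (by positivity)]
  nlinarith

/-- **Global term bound** `|chiTerm n ij| ≤ 42 · layerTerm 1 n (2/3) ij`. [folklore] -/
theorem abs_chiTerm_le (n : ℕ) (ij : ℤ × ℤ) : |chiTerm n ij| ≤ 42 * layerTerm 1 n (2 / 3) ij := by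
  unfold chiTerm
  rw [layerTerm_one_twoThirds, layerTerm_one_twoThirds, abs_mul]
  have hD := chiDen_pos ij.1 ij.2
  have hinv : 0 ≤ ((chiDen ij.1 ij.2 : ℝ)⁻¹) := by positivity
  rw [abs_of_nonneg (pow_nonneg hinv _)]
  have key : ((chiDen ij.1 ij.2 : ℝ)⁻¹) ^ (n + 2) = ((chiDen ij.1 ij.2 : ℝ)⁻¹) ^ n * ((chiDen ij.1 ij.2 : ℝ) ^ 2)⁻¹ := by
    rw [pow_add, ← inv_pow]
  rw [key]
  have h := abs_chiCubic_le ij.1 ij.2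
  have hpow : 0 ≤ ((chiDen ij.1 ij.2 : ℝ)⁻¹) ^ n := pow_nonneg hinv n
  calc |(chiCubic ij.1 ij.2 : ℝ)| * (((chiDen ij.1 ij.2 : ℝ)⁻¹) ^ n * ((chiDen ij.1 ij.2 : ℝ) ^ 2)⁻¹)
      ≤ 42 * (chiDen ij.1 ij.2 : ℝ) ^ 2 * (((chiDen ij.1 ij.2 : ℝ)⁻¹) ^ n * ((chiDen ij.1 ij.2 : ℝ) ^ 2)⁻¹) :=
        mul_le_mul_of_nonneg_right h (by positivity)
    _ = 42 * ((chiDen ij.1 ij.2 : ℝ)⁻¹) ^ n := by field_simp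

/-- **Shell term bound**: outside `box R`, `|chiTerm n ij| ≤ (72/(R+1)) · layerTerm 1 n (2/3) ij`. [folklore] -/
theorem abs_chiTerm_le_of_not_mem_box (n : ℕ) {R : ℕ} {ij : ℤ × ℤ} (h : ij ∉ box R) :
    |chiTerm n ij| ≤ 72 / ((R : ℝ) + 1) * layerTerm 1 n (2 / 3) ij := by
  unfold chiTerm
  rw [layerTerm_one_twoThirds, layerTerm_one_twoThirds, abs_mul]
  have hD := chiDen_pos ij.1 ij.2
  have hinv : 0 ≤ ((chiDen ij.1 ij.2 : ℝ)⁻¹) := by positivity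
  rw [abs_of_nonneg (pow_nonneg hinv _)]
  have key : ((chiDen ij.1 ij.2 : ℝ)⁻¹) ^ (n + 2) = ((chiDen ij.1 ij.2 : ℝ)⁻¹) ^ n * ((chiDen ij.1 ij.2 : ℝ) ^ 2)⁻¹ := by
    rw [pow_add, ← inv_pow]
  rw [key]
  have hb := abs_chiCubic_le_of_not_mem_box h
  calc |(chiCubic ij.1 ij.2 : ℝ)| * (((chiDen ij.1 ij.2 : ℝ)⁻¹) ^ n * ((chiDen ij.1 ij.2 : ℝ) ^ 2)⁻¹)
      ≤ 72 / ((R : ℝ) + 1) * (chiDen ij.1 ij.2 : ℝ) ^ 2 * (((chiDen ij.1 ij.2 : ℝ)⁻¹) ^ n * ((chiDen ij.1 ij.2 : ℝ) ^ 2)⁻¹) :=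
        mul_le_mul_of_nonneg_right hb (by positivity)
    _ = 72 / ((R : ℝ) + 1) * ((chiDen ij.1 ij.2 : ℝ)⁻¹) ^ n := by field_simp

/-- **Summability** of the chirality family for `n ≥ 2` (dominated by `42 · layerTerm 1 n (2/3)`). [folklore] -/
theorem chiTerm_summable {n : ℕ} (hn : 2 ≤ n) : Summable (chiTerm n) := by
  have hg : Summable fun ij => 42 * layerTerm 1 n (2 / 3) ij :=
    (layerTerm_summable (δ := 1) (by norm_num) (s := 2 / 3) (by norm_num) hn).mul_left 42
  exact Summable.of_norm_bounded hg fun ij => by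
    rw [Real.norm_eq_abs]; exact abs_chiTerm_le n ij

/-! ## The kernel evaluators -/

/-- The selected part of the weight as a natural number: `C⁺ = max(C,0)` (`sgn = 0`) resp. `C⁻ = max(−C,0)` (`sgn ≠ 0`).
[this file · kind: definition] -/
def chiWeight (sgn : ℕ) (i j : ℤ) : ℕ :=
  if sgn = 0 then (chiCubic i j).toNat else (-chiCubic i j).toNat

/-- Weighted floor term `C^{±}(i,j) · ⌊M / D(i,j)ᵉ⌋` at the shifted indices `(ii − R, jj − R)`. [this file · kind: definition] -/
def chiFloorTerm (sgn R e M ii jj : ℕ) : ℕ :=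
  chiWeight sgn ((ii : ℤ) - R) ((jj : ℤ) - R) * (M / (chiDen ((ii : ℤ) - R) ((jj : ℤ) - R)).toNat ^ e)

/-- Weight term `C^{±}(i,j)` at the shifted indices. [this file · kind: definition] -/
def chiMassTerm (sgn R ii jj : ℕ) : ℕ :=
  chiWeight sgn ((ii : ℤ) - R) ((jj : ℤ) - R)

/-- Inner structural loop `∑_{jj < m} f ii jj` (kernel-evaluable). [this file · kind: definition] -/
def loopJ (f : ℕ → ℕ → ℕ) (ii : ℕ) : ℕ → ℕ
  | 0 => 0
  | m + 1 => loopJ f ii m + f ii m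

/-- Outer structural loop `∑_{ii < m} ∑_{jj < w} f ii jj`. [this file · kind: definition] -/
def loopI (f : ℕ → ℕ → ℕ) (w : ℕ) : ℕ → ℕ
  | 0 => 0
  | m + 1 => loopI f w m + loopJ f m w

/-- **The weighted box floor sum** `∑_{|i|,|j| ≤ R} C^{±}(i,j)·⌊M/D(i,j)ᵉ⌋`. [this file · kind: definition] -/
def chiFloorSum (sgn R e M : ℕ) : ℕ :=
  loopI (chiFloorTerm sgn R e M) (2 * R + 1) (2 * R + 1)

/-- **The weight mass** `∑_{|i|,|j| ≤ R} C^{±}(i,j)` (the floor slack). [this file · kind: definition] -/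
def chiMass (sgn R : ℕ) : ℕ :=
  loopI (chiMassTerm sgn R) (2 * R + 1) (2 * R + 1)

/-- A tiny sanity evaluation: the `3 × 3` box at `e = 5`, `M = 32` sees the three nearest bonds (`C = 8`, `D = 1`: `8·32` each),
the second shell `(−1,−1), (1,−1), (−1,1)` (`C = −64`, `D = 2`: `64·⌊32/32⌋` each) and nothing else from the positive side
beyond `(1,0), (0,1)` (`C = 80`, `D = 3`, `⌊32/243⌋ = 0`). [folklore] -/
example : chiFloorSum 0 1 5 32 = 768 ∧ chiFloorSum 1 1 5 32 = 192 := by decide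

/-- The loops are `Finset.range` sums. [folklore] -/
theorem loopJ_eq (f : ℕ → ℕ → ℕ) (ii m : ℕ) : loopJ f ii m = ∑ jj ∈ range m, f ii jj := by
  induction m with
  | zero => rfl
  | succ m ih => rw [loopJ, ih, sum_range_succ]

/-- The loops are `Finset.range` sums. [folklore] -/
theorem loopI_eq (f : ℕ → ℕ → ℕ) (w m : ℕ) : loopI f w m = ∑ ii ∈ range m, ∑ jj ∈ range w, f ii jj := by
  induction m with
  | zero => rfl
  | succ m ih => rw [loopI, ih, sum_range_succ, loopJ_eq]

/-- `C⁺ − C⁻ = C` through the casts. [folklore] -/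
theorem chiWeight_sub (i j : ℤ) : ((chiWeight 0 i j : ℕ) : ℝ) - ((chiWeight 1 i j : ℕ) : ℝ) = (chiCubic i j : ℝ) := by
  unfold chiWeight
  simp only [if_true, one_ne_zero, if_false]
  exact_mod_cast Int.toNat_sub_toNat_neg (chiCubic i j)

/-- The real target of one floor term: `M · D^{-e}` at the shifted indices. [this file · kind: definition] -/
def chiTarget (R e M ii jj : ℕ) : ℝ :=
  (M : ℝ) * (((chiDen ((ii : ℤ) - R) ((jj : ℤ) - R) : ℝ))⁻¹) ^ e

/-- **Floor sandwich**: `⌊M/Dᵉ⌋ ≤ M·D^{-e} ≤ ⌊M/Dᵉ⌋ + 1`. [folklore] -/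
theorem floor_sandwich (R e M ii jj : ℕ) :
    ((M / (chiDen ((ii : ℤ) - R) ((jj : ℤ) - R)).toNat ^ e : ℕ) : ℝ) ≤ chiTarget R e M ii jj ∧
      chiTarget R e M ii jj ≤ ((M / (chiDen ((ii : ℤ) - R) ((jj : ℤ) - R)).toNat ^ e : ℕ) : ℝ) + 1 := by
  unfold chiTarget
  set N := chiDen ((ii : ℤ) - R) ((jj : ℤ) - R) with hNdef
  have hN : 1 ≤ N := one_le_chiDen _ _
  have hNc : ((N.toNat : ℕ) : ℝ) = (N : ℝ) := by
    have : ((N.toNat : ℕ) : ℤ) = N := Int.toNat_of_nonneg (by omega)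
    exact_mod_cast this
  have hNpos : (0 : ℝ) < (N : ℝ) := by
    have : (1 : ℝ) ≤ (N : ℝ) := by exact_mod_cast hN
    linarith
  set d : ℕ := N.toNat ^ e with hddef
  have hdc : (d : ℝ) = (N : ℝ) ^ e := by rw [hddef, Nat.cast_pow, hNc]
  have hdpos : (0 : ℝ) < d := by rw [hdc]; positivity
  have key : (M : ℝ) * ((N : ℝ)⁻¹) ^ e = (M : ℝ) / d := by rw [hdc, inv_pow, div_eq_mul_inv]
  rw [key]
  constructor
  · exact Nat.cast_div_le
  · have hdiv := Nat.div_add_mod M d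
    have hmod := Nat.mod_lt M (show 0 < d by exact_mod_cast hdpos)
    have hreal : (M : ℝ) < (d : ℝ) * ((M / d : ℕ) : ℝ) + d := by
      have : (M : ℝ) = (d : ℝ) * ((M / d : ℕ) : ℝ) + ((M % d : ℕ) : ℝ) := by exact_mod_cast hdiv.symm
      have h2 : ((M % d : ℕ) : ℝ) < d := by exact_mod_cast hmod
      linarith
    rw [div_le_iff₀ hdpos]
    nlinarith

/-- The box part of `T_n` through the shifted range indices: `M · ∑_{box R} chiTerm n = ∑_{ii,jj} (C⁺ − C⁻)·(M·D^{-(n+2)})`.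
[folklore] -/
theorem sum_box_chiTerm_eq (n R M : ℕ) :
    (M : ℝ) * ∑ ij ∈ box R, chiTerm n ij =
      ∑ ii ∈ range (2 * R + 1), ∑ jj ∈ range (2 * R + 1),
        (((chiMassTerm 0 R ii jj : ℕ) : ℝ) - ((chiMassTerm 1 R ii jj : ℕ) : ℝ)) * chiTarget R (n + 2) M ii jj := by
  rw [mul_sum, sum_box_eq_sum_range]
  refine sum_congr rfl fun ii _ => sum_congr rfl fun jj _ => ?_
  unfold chiMassTerm chiTarget chiTerm
  rw [chiWeight_sub, layerTerm_one_twoThirds]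
  ring

/-- Casting the structural loop to a real double `range` sum. [folklore] -/
theorem cast_loopI (f : ℕ → ℕ → ℕ) (w m : ℕ) :
    ((loopI f w m : ℕ) : ℝ) = ∑ ii ∈ range m, ∑ jj ∈ range w, ((f ii jj : ℕ) : ℝ) := by
  rw [loopI_eq]; push_cast; rfl

/-- **Per-site sandwich**: `P − N − W⁻ ≤ (W⁺ − W⁻)·(M·D^{-e}) ≤ P + W⁺ − N` termwise. [folklore] -/
theorem chiRange_sandwich (e R M ii jj : ℕ) :
    ((chiFloorTerm 0 R e M ii jj : ℕ) : ℝ) - chiFloorTerm 1 R e M ii jj - chiMassTerm 1 R ii jj ≤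
        (((chiMassTerm 0 R ii jj : ℕ) : ℝ) - chiMassTerm 1 R ii jj) * chiTarget R e M ii jj ∧
      (((chiMassTerm 0 R ii jj : ℕ) : ℝ) - chiMassTerm 1 R ii jj) * chiTarget R e M ii jj ≤
        ((chiFloorTerm 0 R e M ii jj : ℕ) : ℝ) + chiMassTerm 0 R ii jj - chiFloorTerm 1 R e M ii jj := by
  obtain ⟨h1, h2⟩ := floor_sandwich R e M ii jj
  unfold chiFloorTerm chiMassTerm
  push_cast
  set w0 : ℝ := ((chiWeight 0 ((ii : ℤ) - R) ((jj : ℤ) - R) : ℕ) : ℝ)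
  set w1 : ℝ := ((chiWeight 1 ((ii : ℤ) - R) ((jj : ℤ) - R) : ℕ) : ℝ)
  set fl : ℝ := ((M / (chiDen ((ii : ℤ) - R) ((jj : ℤ) - R)).toNat ^ e : ℕ) : ℝ)
  have hw0 : 0 ≤ w0 := by positivity
  have hw1 : 0 ≤ w1 := by positivity
  constructor <;> nlinarith

/-- **Certified enclosure of the box part**:
`(P − N − W⁻)/M ≤ ∑_{box R} chiTerm n ≤ (P + W⁺ − N)/M` with `P, N = chiFloorSum 0/1 R (n+2) M`, `W± = chiMass 0/1 R`.
[folklore] -/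
theorem sum_box_chiTerm_mem (n R : ℕ) {M : ℕ} (hM : 0 < M) :
    ((chiFloorSum 0 R (n + 2) M : ℝ) - chiFloorSum 1 R (n + 2) M - chiMass 1 R) / M ≤ ∑ ij ∈ box R, chiTerm n ij ∧
      ∑ ij ∈ box R, chiTerm n ij ≤ ((chiFloorSum 0 R (n + 2) M : ℝ) + chiMass 0 R - chiFloorSum 1 R (n + 2) M) / M := by
  have hM' : (0 : ℝ) < M := by exact_mod_cast hM
  have hbox := sum_box_chiTerm_eq n R M
  have eP : (chiFloorSum 0 R (n + 2) M : ℝ) = _ := cast_loopI (chiFloorTerm 0 R (n + 2) M) (2 * R + 1) (2 * R + 1)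
  have eN : (chiFloorSum 1 R (n + 2) M : ℝ) = _ := cast_loopI (chiFloorTerm 1 R (n + 2) M) (2 * R + 1) (2 * R + 1)
  have eWp : (chiMass 0 R : ℝ) = _ := cast_loopI (chiMassTerm 0 R) (2 * R + 1) (2 * R + 1)
  have eWn : (chiMass 1 R : ℝ) = _ := cast_loopI (chiMassTerm 1 R) (2 * R + 1) (2 * R + 1)
  have hlo := sum_le_sum fun ii (_ : ii ∈ range (2 * R + 1)) =>
    sum_le_sum fun jj (_ : jj ∈ range (2 * R + 1)) => (chiRange_sandwich (n + 2) R M ii jj).1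
  have hhi := sum_le_sum fun ii (_ : ii ∈ range (2 * R + 1)) =>
    sum_le_sum fun jj (_ : jj ∈ range (2 * R + 1)) => (chiRange_sandwich (n + 2) R M ii jj).2
  simp only [sum_sub_distrib, sum_add_distrib] at hlo hhi
  rw [← eP, ← eN, ← eWn, ← hbox] at hlo
  rw [← eP, ← eN, ← eWp, ← hbox] at hhi
  constructor
  · rw [div_le_iff₀ hM']; linarith
  · rw [le_div_iff₀ hM']; linarith

/-! ## Tail and the parametric enclosure -/

/-- **The tail bound** beyond `box R` for `T_{d+1}` (`d ≥ 1`): `(72/(R+1)) · (24/d) · (3/(R²+2))ᵈ`. [this file · kind: definition] -/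
def chiTail (d R : ℕ) : ℝ :=
  72 / ((R : ℝ) + 1) * (24 / (d : ℝ)) * (3 / ((R : ℝ) ^ 2 + 2)) ^ d

/-- **Tail estimate**: `|∑'_{ij ∉ box R} chiTerm (d+1) ij| ≤ chiTail d R` (`d ≥ 1`), through the kit's `tsum_compl_box_le` at
pattern `1`, shift `2/3`. [folklore] -/
theorem abs_tsum_compl_chiTerm_le {d : ℕ} (hd : 1 ≤ d) (R : ℕ) :
    |∑' ij : {ij : ℤ × ℤ // ij ∉ box R}, chiTerm (d + 1) ij| ≤ chiTail d R := by
  have hR : 0 < (if (1 : ℕ) = 0 then 3 / 4 else 1 / 3 : ℝ) * (R : ℝ) ^ 2 + 2 / 3 := by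
    simp only [one_ne_zero, if_false]; positivity
  have hkit := tsum_compl_box_le (δ := 1) (by norm_num) (s := 2 / 3) (by norm_num) hd hR
  simp only [one_ne_zero, if_false] at hkit
  -- summable majorant on the complement subtype
  have hsum : Summable fun ij : {ij : ℤ × ℤ // ij ∉ box R} => layerTerm 1 (d + 1) (2 / 3) (ij : ℤ × ℤ) :=
    (layerTerm_summable (δ := 1) (by norm_num) (s := 2 / 3) (by norm_num) (show 2 ≤ d + 1 by omega)).subtype _
  have hg := (hsum.mul_left (72 / ((R : ℝ) + 1))).hasSum
  have hbd := tsum_of_norm_bounded hg fun ij : {ij : ℤ × ℤ // ij ∉ box R} => by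
    rw [Real.norm_eq_abs]
    exact abs_chiTerm_le_of_not_mem_box (d + 1) ij.2
  rw [Real.norm_eq_abs] at hbd
  refine hbd.trans ?_
  rw [(hsum.tsum_mul_left (72 / ((R : ℝ) + 1)))]
  have h72 : (0 : ℝ) ≤ 72 / ((R : ℝ) + 1) := by positivity
  refine (mul_le_mul_of_nonneg_left hkit h72).trans (le_of_eq ?_)
  unfold chiTail
  have hR2 : (0 : ℝ) < (R : ℝ) ^ 2 + 2 := by positivity
  have hd0 : (0 : ℝ) < d := by exact_mod_cast hd
  rw [show (1 / 3 : ℝ) * (R : ℝ) ^ 2 + 2 / 3 = ((R : ℝ) ^ 2 + 2) / 3 by ring, inv_div]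
  field_simp
  ring

/-- **The lattice constant splits** as box part plus complement tail (`d + 1 ≥ 2`). [folklore] -/
theorem chiSum_eq_box_add_compl {d : ℕ} (hd : 1 ≤ d) (R : ℕ) :
    chiSum (d + 1) = ∑ ij ∈ box R, chiTerm (d + 1) ij + ∑' ij : {ij : ℤ × ℤ // ij ∉ box R}, chiTerm (d + 1) ij :=
  ((chiTerm_summable (n := d + 1) (by omega)).sum_add_tsum_compl (s := box R)).symm

/-- **PARAMETRIC ENCLOSURE OF `T_{d+1}`** from four kernel facts (`d ≥ 1`, `M > 0`):
`(P − N − W⁻)/M − chiTail d R ≤ T_{d+1} ≤ (P + W⁺ − N)/M + chiTail d R`. [folklore] -/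
theorem chiSum_mem_of_kernel {d R M : ℕ} (hd : 1 ≤ d) (hM : 0 < M) {P N Wp Wn : ℕ}
    (hP : chiFloorSum 0 R (d + 3) M = P) (hN : chiFloorSum 1 R (d + 3) M = N)
    (hWp : chiMass 0 R = Wp) (hWn : chiMass 1 R = Wn) :
    ((P : ℝ) - N - Wn) / M - chiTail d R ≤ chiSum (d + 1) ∧
      chiSum (d + 1) ≤ ((P : ℝ) + Wp - N) / M + chiTail d R := by
  obtain ⟨hlo, hhi⟩ := sum_box_chiTerm_mem (d + 1) R hM
  rw [hP, hN, hWn] at hlo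
  rw [hP, hN, hWp] at hhi
  have htail := abs_tsum_compl_chiTerm_le hd R
  rw [abs_le] at htail
  rw [chiSum_eq_box_add_compl hd R]
  constructor <;> linarith [htail.1, htail.2]

end Summit.AtomisticToContinuum.Crystallization.Theorems.OverbindingBudgetAffineRunCutChiral

end
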